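import Summits.Ventures.YMGap.FlowData.TubeTransferLogNormDerivative
import Summits.Ventures.YMGap.FlowData.TubeFluxNonAnnihilation
import Summits.Ventures.YMGap.Conjectures.TubeStringTension
import Summits.Ventures.LatticeQCDFlow.Scoring.OnePlaquetteBesselRatioMonotone
import HarnessLib

/-!
# Venture YMGap, track Y3 FLOW-DATA — the typed torelon energy `E₁(β)` is CONTINUOUS in `β ≠ 0` on every finite
# tube, and the set of couplings where an instance of the typed law «E₁ < L·(−ln u)» holds is OPEN (theorems only)

HONEST FRAMING: venture file of the cell `pub-ymgap` (QuantumFields programme), track Y3; companion THEOREMS for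
`FlowData/TorelonEnergy.lean` and `Conjectures/TubeStringTension.lean`.  Qualitative regularity only: every finite tube
`(ℤ/L)^k`, every axis, every `β ≠ 0`; no modulus of continuity, no number, no row, nothing about limits or a mass gap,
and nothing is claimed about WHERE the law holds — only that the set of such `β` is open (so each certified strict
instance of the cell's evidence table holds on an open interval of couplings around its `β`, qualitatively).

* `continuous_tubeTransferOperator` — `J ↦ T_{J,k,L}` is continuous in operator norm (it is differentiable:
  `TubeTransferLogNormDerivative.tubeTransferOperator_hasDerivAt`, from the tree's `SliceKernelOperatorDerivative`);
* `continuous_tubeSectorNorm` — every sector norm `J ↦ ‖T_{J,k,L} ∘ P_e‖` is continuous;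
* **`continuousAt_su2TorelonEnergy`** — `β ↦ su2TorelonEnergy β k L μ` is continuous at every `β ≠ 0`
  (`‖T‖ > 0` always, `‖T ∘ P_{ê_μ}‖ > 0` for `β ≠ 0` by `su2_tubeSectorNorm_single_pos`);
* `continuousAt_su2CharacterRatio` — `u(β) = I₂(β)/I₁(β)` is continuous (indeed differentiable, prior venture);
* **`isOpen_setOf_su2TorelonEnergy_lt`** — for every `k, L, μ` the set `{β > 0 | E₁((ℤ/L)^k; β) < L·(−ln u(β))}` is
  open; in particular (`k = 2`, `μ = 0`) the instances of `Conjectures.TubeStringTensionLawDim3` form an open set of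
  couplings for each `L`.

References: T. Kato, *Perturbation Theory for Linear Operators* (1966) II-§5.4 [cite: Kato1966, II-§5.4];
I. Montvay, G. Münster (1994) §3.2.6 [cite: MontvayMunster1994, §3.2.6].
-/

noncomputable section

open scoped BigOperators Topology
open MeasureTheory Filter Function Set
open Literature.MathematicalPhysics.QuantumFieldTheory Literature.MathematicalPhysics.QuantumLattice
open Summit.Ventures.LatticeQCDFlow.Scoring

namespace Summit.Ventures.YMGap.FlowData

/-! ### Continuity of the transfer operator and of the sector norms in the coupling -/

section Continuity

variable {G : Type*} [Group G] [TopologicalSpace G] [IsTopologicalGroup G] [CompactSpace G]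
  [MeasurableSpace G] [BorelSpace G] [SecondCountableTopology G] {n : ℕ}
  (ρ : G →* Matrix (Fin n) (Fin n) ℂ) (z : G) (k L : ℕ) [NeZero L]

/-- **`J ↦ T_{J,k,L}` is continuous in operator norm** (it is differentiable). [cite: Kato1966, II-§5.4] -/
theorem continuous_tubeTransferOperator (hρ : Continuous ρ) :
    Continuous fun J : ℝ => tubeTransferOperator ρ J k L :=
  continuous_iff_continuousAt.2 fun J₀ => by
    obtain ⟨T', hT'⟩ := tubeTransferOperator_hasDerivAt ρ k L hρ J₀
    exact hT'.continuousAt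

/-- **Every sector norm `J ↦ ‖T_{J,k,L} ∘ P_e‖` is continuous.** [folklore] -/
theorem continuous_tubeSectorNorm (hρ : Continuous ρ) (e : Fin k → ZMod 2) :
    Continuous fun J : ℝ => tubeSectorNorm ρ z J k L e := by
  unfold tubeSectorNorm sectorNorm
  exact ((continuous_tubeTransferOperator ρ k L hρ).clm_comp continuous_const).norm

/-- Every flux energy `J ↦ E_e(J)` is continuous at each `J` where the sector is not annihilated. [folklore] -/
theorem continuousAt_tubeFluxEnergy (hρ : Continuous ρ) (e : Fin k → ZMod 2) {J : ℝ}
    (hpos : 0 < tubeSectorNorm ρ z J k L e) :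
    ContinuousAt (fun J : ℝ => tubeFluxEnergy ρ z J k L e) J := by
  unfold tubeFluxEnergy fluxEnergy
  refine ContinuousAt.sub ?_ ?_
  · exact ((continuous_tubeTransferOperator ρ k L hρ).norm.continuousAt).log
      (norm_tubeTransferOperator_pos J k L hρ).ne'
  · exact ((continuous_tubeSectorNorm ρ z k L hρ e).continuousAt).log hpos.ne'

end Continuity

/-! ### The cell's object: `E₁(β)` continuous on `β ≠ 0`; the law's instances form an open set of couplings -/

section SU2

open Literature.MathematicalPhysics.QuantumLattice (fundamentalRep continuous_fundamentalRep)
open Summit.Ventures.YMGap.Conjectures (su2CharacterRatio)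

/-- **The typed torelon energy is continuous in the coupling at every `β ≠ 0`**, on every finite tube `(ℤ/L)^k`
and along every axis. [cite: Kato1966, II-§5.4] -/
theorem continuousAt_su2TorelonEnergy {β : ℝ} (hβ : β ≠ 0) (k L : ℕ) [NeZero L] (μ : Fin k) :
    ContinuousAt (fun β : ℝ => su2TorelonEnergy β k L μ) β := by
  haveI : SecondCountableTopology (Matrix.specialUnitaryGroup (Fin 2) ℂ) :=
    Literature.MathematicalPhysics.QuantumLattice.secondCountableTopology_su2
  have h : ContinuousAt (fun J : ℝ => tubeFluxEnergy (fundamentalRep (Fin 2)) su2MinusOne J k L (Pi.single μ 1))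
      (β / 2) :=
    continuousAt_tubeFluxEnergy (fundamentalRep (Fin 2)) su2MinusOne k L (continuous_fundamentalRep (Fin 2))
      (Pi.single μ 1) (su2_tubeSectorNorm_single_pos hβ k L μ)
  have h2 : ContinuousAt (fun β : ℝ => β / 2) β := (continuous_id.div_const 2).continuousAt
  exact ContinuousAt.comp (f := fun β : ℝ => β / 2)
    (g := fun J : ℝ => tubeFluxEnergy (fundamentalRep (Fin 2)) su2MinusOne J k L (Pi.single μ 1)) h h2

/-- `u(β) = su2CharacterRatio β` is continuous (it is differentiable, prior venture). [folklore] -/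
theorem continuous_su2CharacterRatio : Continuous su2CharacterRatio :=
  continuous_iff_continuousAt.2 fun β => (hasDerivAt_onePlaquetteExpectSU2_cos β).continuousAt

/-- **The instances of the typed law form an open set of couplings**: for every slice dimension `k`, side `L` and
axis `μ`, `{β > 0 | su2TorelonEnergy β k L μ < L·(−ln u(β))}` is open (continuity of both sides on `β > 0`).
Nothing is claimed about which `β` belong to it. [folklore] -/
theorem isOpen_setOf_su2TorelonEnergy_lt (k L : ℕ) [NeZero L] (μ : Fin k) :
    IsOpen {β : ℝ | 0 < β ∧ su2TorelonEnergy β k L μ < (L : ℝ) * (-Real.log (su2CharacterRatio β))} := by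
  rw [isOpen_iff_mem_nhds]
  rintro β ⟨hβ, hlt⟩
  have h1 : ContinuousAt (fun β : ℝ => su2TorelonEnergy β k L μ) β := continuousAt_su2TorelonEnergy hβ.ne' k L μ
  have h2 : ContinuousAt (fun β : ℝ => (L : ℝ) * (-Real.log (su2CharacterRatio β))) β :=
    (continuous_const.continuousAt).mul
      ((continuous_su2CharacterRatio.continuousAt.log (Conjectures.su2CharacterRatio_pos hβ).ne').neg)
  have h3 : ∀ᶠ b in 𝓝 β, su2TorelonEnergy b k L μ < (L : ℝ) * (-Real.log (su2CharacterRatio b)) :=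
    h1.eventually_lt h2 hlt
  filter_upwards [h3, Ioi_mem_nhds hβ] with b hb hb0
  exact ⟨hb0, hb⟩

/-- In particular the instances of `Conjectures.TubeStringTensionLawDim3` (`k = 2`, axis `0`) form, for each `L`, an
open set of couplings `β > 0`. [folklore] -/
theorem isOpen_setOf_tubeStringTensionLawDim3_instance (L : ℕ) [NeZero L] :
    IsOpen {β : ℝ | 0 < β ∧ su2TorelonEnergy β 2 L 0 < (L : ℝ) * (-Real.log (su2CharacterRatio β))} :=
  isOpen_setOf_su2TorelonEnergy_lt 2 L 0

end SU2

end Summit.Ventures.YMGap.FlowData
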